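/-
Copyright: the b2b-balaban cell (near-miss cell 7), T⁴-continuum CRUX team (coordinator ruling e34b3e0c item (2)),
lineage t4-ne7b-formalise-leaf-04 (gen 24). Released under the licence of the surrounding project.
-/
import Summits.QuantumFields.BalabanUV.T4Continuum.Spine.NE7b.HealingMap

/-!
# The Peierls healing map, step H6 (COVER + SURVIVAL) in the kernel: counting the pinned components BY BIRTH SCALE
# turns per-age quotient decay into the tree's two-rate majorant, hence into NE7b's output shape with an EXPLICIT
# weight `W K = vol·(Λσ∕(1−Λσ))·(Λσ)^{K − j⋆(K)}` (route R-H of `t4/ROUTES-NE7b.md` v2; sibling of `…NE7b.HealingMap`)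

Cell `pub-balaban`, sub-cell `t4`, spine estimate NE7b (node U5c), candidate route R-H «Peierls healing map» (seat
`t4-ne7b-idea-1` gen 2), step H6: «`W K := Σ_{C ∈ X_K} q_K(C)` … per pinned anchor the genealogies with `m` events and
shape data are counted by [Balaban1989LargeFieldII] p. 383's entropy factors and the tree's two-rate majorant
(`twoRate_majorant_le`, `summable_weightMajorant`, `survivalRate_pos_iff` …)».  The sibling module
`…NE7b.HealingMap` reduces NE7b's output `T4WeightBudget.RelWeightBound` to two runs' `HealingLaws` plus a majorant
`Σ_x q K x ≤ V·r^{K − j⋆(K)}` (`exists_relWeightBound_of_healing_majorant`).  THIS file supplies that majorant from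
the two COUNTING hypotheses in the shape the cell's reading of NE7b uses everywhere (T4-DAG §2 U5c, `T4WeightBudget`
§3): every pinned old component `x ∈ X K` has a BIRTH SCALE `birth K x < j⋆(K)`; at most `vol·Λ^{K−j}` of them are
born at scale `j` (`Λ` = positional entropy `L⁴` per scale of age times the genealogy-shape entropy per scale); and
a component born at `j` has quotient `q K x ≤ σ^{K−j}` (`σ` = the per-step survival factor, `σ = e^{−(p−E)∕N}` in
the tree's reading: `p` banked per event, `E` entropy per event, events at least every `N` steps — H4∕H5 of the
route).  Then (kernel, [folklore]):
* `sum_le_twoRate_sum` — `Σ_{x ∈ X K} q K x ≤ vol·Σ_{j < j⋆} Λ^{K−j}σ^{K−j}` (fibrewise by birth scale);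
* `sum_le_twoRate_majorant` — `… ≤ vol·(Λσ∕(1−Λσ))·(Λσ)^{K−j⋆}` for `Λσ < 1`, `j⋆ ≤ K` (the tree's
  `T4WeightBudget.twoRate_majorant_le` BY NAME, reshaped to `V·r^{K−j⋆}`);
* **`exists_relWeightBound_of_healing_count`** — two runs' `HealingLaws` + the two counting hypotheses per run +
  `0 < Λσ < 1` + a positive fraction of old steps `c·K ≤ K − j⋆(K)` ⟹ `∃ K₀, RelWeightBound l₀ T A B (eventually-Bad)
  (indicator W)` with the EXPLICIT `W K = vol·(Λσ∕(1−Λσ))·(Λσ)^{K−j⋆(K)}`;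
* **`exists_relWeightBound_of_healing_survival`** — the same with `Λ = e^{4·log L}`, `σ = e^{−(p−E)∕N}` under THE
  CONDITION OF NE7b `0 < survivalRate p E N L` (⟺ `p∕N > 4·log L + E∕N`, `T4WeightBudget.survivalRate_pos_iff`;
  `exp_entropy_mul_exp_survival_lt_one_iff` BY NAME).

NOT HERE (honest).  That Bałaban's pinned pending components satisfy the two counting hypotheses — the birth-scale
count with ITS `Λ` (position × genealogy-shape entropy, p. 383) and the per-age decay with ITS `σ` (H3's local
quotient bound + H4's banked slack + H5's age ⇒ events) — is the route's OPEN analytic content and stays DISPLAYED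
(hypotheses `hcount`, `hq`).  Nothing of Bałaban's is asserted; no `def … : Prop`; zero `sorry`.  BY-NAME EFFECT ON
THE WALL (`WALL-NE7b-P1.md` §2): NONE.  NE7b NOT PRINTED, NOT PROVED; spine PROVED 0∕9; rung (B)+1 on a FINITE torus
T⁴ — NOT infinite volume, NOT the mass gap, NOT Clay.  POLICY (ruling e34b3e0c): crux-route work of item (2), asked
by name in ROUTES-NE7b v2 §3; NOT a `T4Continuum/Support` leaf.
HONEST DEPENDENCY: continuum YM on T⁴ ⇐ BetaPertH ∧ nine spine estimates (0/9 proved); BetaPertH ⇐ (D1) ∧ (D4) ∧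
CAP+tail; G-an2-4 gates asym, D1 and NE2/3/4.  This file changes none of it.
-/

set_option autoImplicit false

open Finset
open Literature.MathematicalPhysics.QuantumFieldTheory.Balaban1983to89
open Literature.MathematicalPhysics.QuantumFieldTheory.Balaban1983to89.T4WeightBudget

namespace Summit.QuantumFields.BalabanUV.T4Continuum.NE7b.HealingMap

/-! ## §1 Counting pinned components by birth scale -/

section Count

variable {α : Type*}

/-- **COUNTING BY BIRTH SCALE**: if every pinned component `x ∈ X` is born at a scale `birth x < j⋆`, at most
`vol·Λ^{K−j}` of them are born at scale `j`, and a component born at `j` has (non-negative-free) quotient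
`q x ≤ σ^{K−j}` with `σ ≥ 0`, then `Σ_{x ∈ X} q x ≤ vol·Σ_{j < j⋆} Λ^{K−j}·σ^{K−j}`. [folklore] -/
theorem sum_le_twoRate_sum (X : Finset α) (q : α → ℝ) (birth : α → ℕ) {vol Λ σ : ℝ} {jstar K : ℕ}
    (hσ : 0 ≤ σ) (hbirth : ∀ x ∈ X, birth x < jstar)
    (hcount : ∀ j, j < jstar → ((X.filter fun x => birth x = j).card : ℝ) ≤ vol * Λ ^ (K - j))
    (hq : ∀ x ∈ X, q x ≤ σ ^ (K - birth x)) :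
    ∑ x ∈ X, q x ≤ vol * ∑ j ∈ range jstar, Λ ^ (K - j) * σ ^ (K - j) := by
  have hmaps : ∀ x ∈ X, birth x ∈ range jstar := fun x hx => mem_range.mpr (hbirth x hx)
  rw [← Finset.sum_fiberwise_of_maps_to hmaps, Finset.mul_sum]
  refine Finset.sum_le_sum fun j hj => ?_
  calc ∑ x ∈ X with birth x = j, q x ≤ ∑ x ∈ X with birth x = j, σ ^ (K - j) :=
        Finset.sum_le_sum fun x hx => by
          obtain ⟨hxX, hxj⟩ := Finset.mem_filter.mp hx
          simpa [hxj] using hq x hxX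
    _ = ((X.filter fun x => birth x = j).card : ℝ) * σ ^ (K - j) := by rw [Finset.sum_const, nsmul_eq_mul]
    _ ≤ vol * Λ ^ (K - j) * σ ^ (K - j) :=
        mul_le_mul_of_nonneg_right (hcount j (mem_range.mp hj)) (pow_nonneg hσ _)
    _ = vol * (Λ ^ (K - j) * σ ^ (K - j)) := by ring

/-- **… HENCE THE TWO-RATE MAJORANT** (the tree's `T4WeightBudget.twoRate_majorant_le` BY NAME, reshaped): with
`Λ, σ, vol ≥ 0`, `Λσ < 1` and `j⋆ ≤ K`, `Σ_{x ∈ X} q x ≤ vol·(Λσ∕(1−Λσ))·(Λσ)^{K−j⋆}` — the shape `V·r^{K−j⋆}`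
of `…HealingMap.exists_relWeightBound_of_healing_majorant`. [folklore] -/
theorem sum_le_twoRate_majorant (X : Finset α) (q : α → ℝ) (birth : α → ℕ) {vol Λ σ : ℝ} {jstar K : ℕ}
    (hvol : 0 ≤ vol) (hΛ : 0 ≤ Λ) (hσ : 0 ≤ σ) (hr : Λ * σ < 1) (hj : jstar ≤ K)
    (hbirth : ∀ x ∈ X, birth x < jstar)
    (hcount : ∀ j, j < jstar → ((X.filter fun x => birth x = j).card : ℝ) ≤ vol * Λ ^ (K - j))
    (hq : ∀ x ∈ X, q x ≤ σ ^ (K - birth x)) :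
    ∑ x ∈ X, q x ≤ vol * (Λ * σ / (1 - Λ * σ)) * (Λ * σ) ^ (K - jstar) := by
  have h1 := sum_le_twoRate_sum X q birth hσ hbirth hcount hq
  have h2 := twoRate_majorant_le hvol hΛ hσ hr hj (vol := vol)
  have h3 : vol * ((Λ * σ) ^ (K - jstar + 1) / (1 - Λ * σ)) =
      vol * (Λ * σ / (1 - Λ * σ)) * (Λ * σ) ^ (K - jstar) := by
    rw [pow_succ]
    ring
  linarith

end Count

/-! ## §2 The END of route R-H with an explicit weight -/

section End

variable {ι α α' : Type*} {l₀ : ℝ} {T : ℕ → Finset ι} {A B : ℕ → ℝ → ι → ℝ} {Bad : ℕ → ℝ → Finset ι}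
  {X : ℕ → Finset α} {Badx : ℕ → α → Finset ι} {heal : ℕ → α → ι → ι} {q : ℕ → α → ℝ}
  {X' : ℕ → Finset α'} {Badx' : ℕ → α' → Finset ι} {heal' : ℕ → α' → ι → ι} {q' : ℕ → α' → ℝ}

/-- **ROUTE R-H, KERNEL END WITH AN EXPLICIT WEIGHT.**  Two runs' healing laws over the same term sets and bad
classes; per run, every pinned old component at cutoff `K` has a birth scale `< j⋆(K)`, at most `vol·Λ^{K−j}` are
born at scale `j`, and one born at `j` has quotient `≤ σ^{K−j}`; `vol, Λ, σ ≥ 0`, `0 < Λσ < 1`; `j⋆(K) ≤ K` and a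
positive fraction of the steps is old, `c·K ≤ K − j⋆(K)`.  THEN some `K₀` gives `T4WeightBudget.RelWeightBound`
(bad classes emptied below `K₀`) with the weight `W K = vol·(Λσ∕(1−Λσ))·(Λσ)^{K−j⋆(K)}` — summable, eventually
`< 1`.  All analytic content (H1 reading, H3–H5 behind `hq`, the p. 383 count behind `hcount`) is DISPLAYED.
[folklore] -/
theorem exists_relWeightBound_of_healing_count {birth : ℕ → α → ℕ} {birth' : ℕ → α' → ℕ}
    {jstar : ℕ → ℕ} {vol Λ σ c : ℝ}
    (hA : HealingLaws l₀ T A Bad X Badx heal q) (hB : HealingLaws l₀ T B Bad X' Badx' heal' q')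
    (hA0 : ∀ K t, |t| ≤ l₀ → ∀ τ, 0 ≤ A K t τ) (hB0 : ∀ K t, |t| ≤ l₀ → ∀ τ, 0 ≤ B K t τ)
    (hvol : 0 ≤ vol) (hΛ : 0 ≤ Λ) (hσ : 0 ≤ σ) (hr0 : 0 < Λ * σ) (hr1 : Λ * σ < 1) (hc : 0 < c)
    (hjK : ∀ K, jstar K ≤ K) (hfrac : ∀ K : ℕ, c * K ≤ ((K - jstar K : ℕ) : ℝ))
    (hbirthA : ∀ K, ∀ x ∈ X K, birth K x < jstar K)
    (hcountA : ∀ K j, j < jstar K → (((X K).filter fun x => birth K x = j).card : ℝ) ≤ vol * Λ ^ (K - j))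
    (hqA : ∀ K, ∀ x ∈ X K, q K x ≤ σ ^ (K - birth K x))
    (hbirthB : ∀ K, ∀ x ∈ X' K, birth' K x < jstar K)
    (hcountB : ∀ K j, j < jstar K → (((X' K).filter fun x => birth' K x = j).card : ℝ) ≤ vol * Λ ^ (K - j))
    (hqB : ∀ K, ∀ x ∈ X' K, q' K x ≤ σ ^ (K - birth' K x)) :
    ∃ K₀ : ℕ, RelWeightBound l₀ T A B (fun K t => if K₀ ≤ K then Bad K t else ∅)
      (Set.indicator {K | K₀ ≤ K} fun K => vol * (Λ * σ / (1 - Λ * σ)) * (Λ * σ) ^ (K - jstar K)) :=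
  exists_relWeightBound_of_healing_majorant hA hB hA0 hB0 hr0 hr1
    (mul_nonneg hvol (div_nonneg hr0.le (by linarith))) hc hfrac
    (fun K => sum_le_twoRate_majorant (X K) (q K) (birth K) hvol hΛ hσ hr1 (hjK K) (hbirthA K) (hcountA K) (hqA K))
    (fun K => sum_le_twoRate_majorant (X' K) (q' K) (birth' K) hvol hΛ hσ hr1 (hjK K) (hbirthB K) (hcountB K)
      (hqB K))

/-- **THE SAME UNDER THE CONDITION OF NE7b** (`T4WeightBudget.survivalRate_pos_iff`: `p∕N > 4·log L + E∕N`): with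
the positional entropy `Λ = e^{4·log L}` per scale of age and the per-step survival factor `σ = e^{−(p−E)∕N}`
(`p` banked per event, `E` entropy per event, an event at least every `N` steps — the cell's reading, T4-DAG §2
U5c), `Λσ < 1` IS `0 < survivalRate p E N L` (`exp_entropy_mul_exp_survival_lt_one_iff` BY NAME), so the END holds
under that sign condition.  [folklore] -/
theorem exists_relWeightBound_of_healing_survival {birth : ℕ → α → ℕ} {birth' : ℕ → α' → ℕ}
    {jstar : ℕ → ℕ} {vol p E N L c : ℝ}
    (hA : HealingLaws l₀ T A Bad X Badx heal q) (hB : HealingLaws l₀ T B Bad X' Badx' heal' q')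
    (hA0 : ∀ K t, |t| ≤ l₀ → ∀ τ, 0 ≤ A K t τ) (hB0 : ∀ K t, |t| ≤ l₀ → ∀ τ, 0 ≤ B K t τ)
    (hvol : 0 ≤ vol) (hrate : 0 < survivalRate p E N L) (hc : 0 < c)
    (hjK : ∀ K, jstar K ≤ K) (hfrac : ∀ K : ℕ, c * K ≤ ((K - jstar K : ℕ) : ℝ))
    (hbirthA : ∀ K, ∀ x ∈ X K, birth K x < jstar K)
    (hcountA : ∀ K j, j < jstar K →
      (((X K).filter fun x => birth K x = j).card : ℝ) ≤ vol * Real.exp (4 * Real.log L) ^ (K - j))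
    (hqA : ∀ K, ∀ x ∈ X K, q K x ≤ Real.exp (-((p - E) / N)) ^ (K - birth K x))
    (hbirthB : ∀ K, ∀ x ∈ X' K, birth' K x < jstar K)
    (hcountB : ∀ K j, j < jstar K →
      (((X' K).filter fun x => birth' K x = j).card : ℝ) ≤ vol * Real.exp (4 * Real.log L) ^ (K - j))
    (hqB : ∀ K, ∀ x ∈ X' K, q' K x ≤ Real.exp (-((p - E) / N)) ^ (K - birth' K x)) :
    ∃ K₀ : ℕ, RelWeightBound l₀ T A B (fun K t => if K₀ ≤ K then Bad K t else ∅)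
      (Set.indicator {K | K₀ ≤ K} fun K =>
        vol * (Real.exp (4 * Real.log L) * Real.exp (-((p - E) / N)) /
          (1 - Real.exp (4 * Real.log L) * Real.exp (-((p - E) / N)))) *
          (Real.exp (4 * Real.log L) * Real.exp (-((p - E) / N))) ^ (K - jstar K)) :=
  exists_relWeightBound_of_healing_count hA hB hA0 hB0 hvol (Real.exp_pos _).le (Real.exp_pos _).le
    (mul_pos (Real.exp_pos _) (Real.exp_pos _)) (exp_entropy_mul_exp_survival_lt_one_iff.mpr hrate) hc hjK hfrac
    hbirthA hcountA hqA hbirthB hcountB hqB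

end End

end Summit.QuantumFields.BalabanUV.T4Continuum.NE7b.HealingMap
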